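import Summits.BirchSwinnertonDyer.BirchSwinnertonDyer.Theorems.AlignedTransportAtTwoMainConjectureOfRankZeroBSDAtTwoFineRoadPerfectDescentSurj
import Literature.NumberTheory.EllipticCurves.KatoFineSelmerDualRelaxedAtInfinity
import Literature.NumberTheory.EllipticCurves.FineSelmerCoefficientMapProofs
import HarnessLib

/-!
# PERFECT DESCENT at the SELMER level (relaxed at `∞`): `res : Sel₀^{rel ∞}(L, E[2]) ≅ Sel₀^{rel ∞}(L(E[2]), E[2])^{Gal(L(E[2])/L)}`
# for `L = K_∞` any `ℤ_p`-extension of any number field — the local conditions descend place by place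

Cell `bsd-f1-sign2`, WIDTH-5 attach seat `bsd-line-att-p5` (gen 5) on line `birth` of crux C2
stmt-BirchSwinnertonDyer-22298 `MainConjectureOfRankZeroBSDAtTwo`; companion of `…FineRoadRelaxedCoefficients` (att-p5 g5:
(A)ₚ^{rel ∞} ⟺ `Sel₀^{rel ∞}(K_∞, E[p])` finite) and of att-p3 g4's `…FineRoadPerfectDescent(Surj)` (the `H¹`-level perfect
descent `H¹(H, E[2]) ≅ H¹(H ⊓ ker ρ̄_{E,2}, E[2])^H`, global and local). A `--supports 22298 --as helper` file.
HONEST FRAMING: THEOREMS ONLY — no definition, no named fact, no `sorry`; BSD is NOT proved by any of this.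

WHAT. The lead's PERFECT-DESCENT.md §3 (ii) identifies `Sel₀(ℚ_∞, N)` (`N = E[2]`) with `Hom_{G_∞}(X_{Σ-cs}(F_∞), N)`,
`F_∞ = ℚ_∞(E[2])`: the GLOBAL step is inflation–restriction for `F_∞/ℚ_∞` (att-p3 g4, kernel), the LOCAL step is «`κ` trivial
at `v` ⟺ `φ_κ(D_w) = 0` for all `w ∣ v`» (`H¹(G_w, N) = 0` for every decomposition group, att-p3 g4, kernel), and the last
step is class field theory upstairs (print). This file packages the first two steps at the level of Greenberg's SELMER GROUPS
in the tree's `(v, σ)`-currency — for the RELAXED-at-`∞` fine conditions (no archimedean clause; the currency of road (b″)'s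
Limʳ and of `…FineRoadRelaxedCoefficients`) — for ANY normal subgroups `H₁ ≤ H₂ ≤ Γ_K` of a number field:

* §1 `mem_strictSelmerGroupOverRelaxedInf_fine_iff_resOfLe` (any normal `H`, any discrete `M`: membership in Greenberg's
  relaxed-at-`∞` strict Selmer group for the FINE data = every `res_{H ⊓ D_v} (conj_σ c)` vanishes);
  **`resOfLe_mem_relaxedFine`** (`res : Sel₀^{rel ∞}(H₂; M) → Sel₀^{rel ∞}(H₁; M)`, any `M`) and
  **`mem_relaxedFine_of_resOfLe_mem`** (the converse whenever every LOCAL restriction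
  `H¹(H₂ ⊓ D_v, M) → H¹(H₁ ⊓ D_v, M)` is injective).
* §2 `M = E[2]`, `H₁ = H ⊓ ker ρ̄_{E,2}`: **`mem_relaxedFine_twoCoeff_iff_resOfLe_mem`** (EVERY normal `H ≤ Γ_K`: `c` is
  fine-relaxed over `K̄^H` iff `res c` is fine-relaxed over `K̄^H(E[2])` — the local injectivity is att-p3 g4's
  `resOfLe_geomTorsion_two_injective`, valid at EVERY place and for EVERY image of `ρ̄`);
  **`image_resOfLe_relaxedFine_twoCoeff_eq`** (the image of `Sel₀^{rel ∞}(H; E[2])` under `res` is EXACTLY the set of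
  `H`-invariant classes of `Sel₀^{rel ∞}(H ⊓ ker ρ̄; E[2])`, by att-p3 g4's `mem_range_resOfLe_geomTorsion_two_iff`) and
  **`finite_relaxedFine_twoCoeff_iff_finite_invariants`** (`Sel₀^{rel ∞}(K_∞, E[2])` is finite iff the `Gal(K̄/K_∞)`-invariant
  part of `Sel₀^{rel ∞}(K_∞(E[2]), E[2])` is finite — any number field, any `ℤ_p`-extension `κ`).

Upstairs `Gal(K̄/K_∞(E[2])) ≤ ker ρ̄_{E,2}` acts TRIVIALLY on `E[2]`, so `Sel₀^{rel ∞}(K_∞(E[2]), E[2])` is a group of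
continuous homomorphisms `Gal(K̄/F_∞) → E[2]` killing every decomposition group at a finite place: the kernel form of the
lead's `Hom(X⁺_{Σ-cs}(F_∞), E[2])` short of class field theory. Composed with `…FineRoadRelaxedCoefficients(RatTwo)`:
(A)₂^{rel ∞}(E/ℚ) ⟺ that invariant group is finite — PERFECT-DESCENT (b), `ℚ_∞`-side, entirely in the kernel.

References: J.-P. Serre, *Galois Cohomology* I §2.6 (inflation–restriction), I §2.5 (conjugation); R. Greenberg, Adv. Stud.
Pure Math. 17 (1989) p. 98 (the `(v, σ)` local conditions); R. Greenberg, LNM 1716 (1999) §3 (restriction maps in the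
cyclotomic tower) and §4 p. 106; the lead's PERFECT-DESCENT.md §3 (ii) (crux workfile, cell bsd-f1-sign2).
-/

set_option autoImplicit false
-- the Theorems namespace of this sub repeats the summit name by design (D-0017 nested layout)
set_option linter.dupNamespace false

noncomputable section

open scoped Classical

namespace Summit.BirchSwinnertonDyer.BirchSwinnertonDyer.Theorems.AlignedTransportAtTwoFineRoad.RelaxedPerfectDescent

open WeierstrassCurve NumberField IsDedekindDomain Field Literature.NumberTheory.EllipticCurves
  Literature.NumberTheory.EllipticCurves.GreenbergSelmer Literature.NumberTheory.GaloisRepresentations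
  Literature.NumberTheory.EllipticCurves.FineSelmerCoefficientMap

universe u

/-! ## §1 Relaxed fine conditions along a restriction `H¹(H₂, M) → H¹(H₁, M)`, `H₁ ≤ H₂` normal in `Γ_K` -/

section Generic

variable {K : Type u} [Field K] [NumberField K]
variable {M : Type u} [AddCommGroup M] [DistribMulAction (absoluteGaloisGroup K) M]
  [TopologicalSpace M] [DiscreteTopology M]

/-- **Membership in Greenberg's relaxed-at-`∞` strict Selmer group for the FINE data, over ANY `L = K̄^H`, as vanishing of
restrictions**: `c ∈ Sel₀^{rel ∞}(H; M)` iff `res_{H ⊓ D_v} (conj_σ c) = 0` for every finite place `v` of `K` and every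
`σ ∈ Γ_K` (the fine datum `M⁺_v = 0` makes the strict condition at `v ∣ p` the same "locally trivial" as at `v ∤ p`,
`mem_strictKer_fineLocalDatum_iff`; no archimedean clause). The case `H = ker κ` is
`RelaxedCoefficients.mem_fineSelmerInftyRelaxedInf_iff_resOfLe`. [cite: Greenberg1989, §1 p. 98] [cite: GreenbergLNM1716, §4 (PDF p. 106)] -/
theorem mem_strictSelmerGroupOverRelaxedInf_fine_iff_resOfLe (H : Subgroup (absoluteGaloisGroup K)) [H.Normal]
    (p : ℕ) (c : subgroupH1 H M) :
    c ∈ strictSelmerGroupOverRelaxedInf H M p (fineData M p) ↔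
      ∀ (v : HeightOneSpectrum (𝓞 K)) (σ : absoluteGaloisGroup K),
        resOfLe M (inf_le_left : H ⊓ decomp v ≤ H) (conjH1 H M σ c) = 0 := by
  rw [mem_strictSelmerGroupOverRelaxedInf_iff]
  constructor
  · rintro ⟨h1, h3⟩ v σ
    by_cases hv : ((p : ℕ) : 𝓞 K) ∈ v.asIdeal
    · exact (mem_strictKer_fineLocalDatum_iff _ v _).1 (h3 v hv σ)
    · exact h1 v hv σ
  · intro h1
    exact ⟨fun v _ σ ↦ h1 v σ, fun v _ σ ↦ (mem_strictKer_fineLocalDatum_iff _ v _).2 (h1 v σ)⟩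

omit [NumberField K] in
/-- Bookkeeping of restrictions: for `H₁ ≤ H₂` and a subgroup `D`, restricting `y ∈ H¹(H₂, M)` to `H₁` and then to
`H₁ ⊓ D` is restricting to `H₂ ⊓ D` and then to `H₁ ⊓ D` (both are `res_{H₁ ⊓ D ≤ H₂}`, `resOfLe_comp`).
[cite: SerreGaloisCohomology1997, I §2.4] -/
theorem resOfLe_inf_resOfLe_eq {H₁ H₂ : Subgroup (absoluteGaloisGroup K)} (h : H₁ ≤ H₂)
    (D : Subgroup (absoluteGaloisGroup K)) (y : subgroupH1 H₂ M) :
    resOfLe M (inf_le_left : H₁ ⊓ D ≤ H₁) (resOfLe M h y) =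
      resOfLe M (inf_le_inf_right D h : H₁ ⊓ D ≤ H₂ ⊓ D) (resOfLe M (inf_le_left : H₂ ⊓ D ≤ H₂) y) := by
  have e1 := congrArg (fun f : subgroupH1 H₂ M →+ subgroupH1 (H₁ ⊓ D) M ↦ f y)
    (resOfLe_comp_holds (M := M) (inf_le_left : H₁ ⊓ D ≤ H₁) h)
  have e2 := congrArg (fun f : subgroupH1 H₂ M →+ subgroupH1 (H₁ ⊓ D) M ↦ f y)
    (resOfLe_comp_holds (M := M) (inf_le_inf_right D h : H₁ ⊓ D ≤ H₂ ⊓ D) (inf_le_left : H₂ ⊓ D ≤ H₂))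
  simp only [AddMonoidHom.comp_apply] at e1 e2
  rw [e1, e2]

/-- **`res : Sel₀^{rel ∞}(H₂; M) → Sel₀^{rel ∞}(H₁; M)`** for normal `H₁ ≤ H₂ ≤ Γ_K` and any discrete `Γ_K`-module `M`: the
restriction of a class locally trivial at every finite place of `K̄^{H₂}` is locally trivial at every finite place of
`K̄^{H₁}` (`conj_σ ∘ res = res ∘ conj_σ`, `resOfLe_comp_conjH1`; then restrict further). [cite: GreenbergLNM1716, §3 (restriction maps)] [cite: SerreGaloisCohomology1997, I §2.5] -/
theorem resOfLe_mem_relaxedFine {H₁ H₂ : Subgroup (absoluteGaloisGroup K)} [H₁.Normal] [H₂.Normal] (h : H₁ ≤ H₂)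
    (p : ℕ) {c : subgroupH1 H₂ M} (hc : c ∈ strictSelmerGroupOverRelaxedInf H₂ M p (fineData M p)) :
    resOfLe M h c ∈ strictSelmerGroupOverRelaxedInf H₁ M p (fineData M p) := by
  rw [mem_strictSelmerGroupOverRelaxedInf_fine_iff_resOfLe] at hc ⊢
  intro v σ
  have hconj := congrArg (fun f : subgroupH1 H₂ M →+ subgroupH1 H₁ M ↦ f c)
    (resOfLe_comp_conjH1_holds (M := M) h σ)
  simp only [AddMonoidHom.comp_apply] at hconj
  rw [← hconj, resOfLe_inf_resOfLe_eq h (decomp v), hc v σ, map_zero]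

/-- **The converse, given LOCAL injectivity**: if `res : H¹(H₂ ⊓ D_v, M) → H¹(H₁ ⊓ D_v, M)` is injective for every finite
place `v` (`H¹(G_w, M) = 0` for the decomposition groups of `K̄^{H₁}/K̄^{H₂}` — e.g. `M = E[2]`, §2), then a class of `H¹(H₂, M)`
whose restriction to `H₁` is fine-relaxed is itself fine-relaxed. [cite: SerreGaloisCohomology1997, I §2.6] [cite: GreenbergLNM1716, §3] -/
theorem mem_relaxedFine_of_resOfLe_mem {H₁ H₂ : Subgroup (absoluteGaloisGroup K)} [H₁.Normal] [H₂.Normal] (h : H₁ ≤ H₂)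
    (p : ℕ)
    (hinj : ∀ v : HeightOneSpectrum (𝓞 K),
      Function.Injective (resOfLe M (inf_le_inf_right (decomp v) h : H₁ ⊓ decomp v ≤ H₂ ⊓ decomp v)))
    {c : subgroupH1 H₂ M} (hc : resOfLe M h c ∈ strictSelmerGroupOverRelaxedInf H₁ M p (fineData M p)) :
    c ∈ strictSelmerGroupOverRelaxedInf H₂ M p (fineData M p) := by
  rw [mem_strictSelmerGroupOverRelaxedInf_fine_iff_resOfLe] at hc ⊢
  intro v σ
  apply hinj v
  have hconj := congrArg (fun f : subgroupH1 H₂ M →+ subgroupH1 H₁ M ↦ f c)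
    (resOfLe_comp_conjH1_holds (M := M) h σ)
  simp only [AddMonoidHom.comp_apply] at hconj
  rw [map_zero, ← resOfLe_inf_resOfLe_eq h (decomp v), hconj]
  exact hc v σ

end Generic

/-! ## §2 `M = E[2]`: the local conditions descend along `K̄^H(E[2]) / K̄^H` for EVERY normal `H` (perfect descent) -/

section TwoTorsion

variable {K : Type} [Field K] [NumberField K] (W : WeierstrassCurve K) [W.IsElliptic]

/-- **`c ∈ Sel₀^{rel ∞}(H; E[2]) ⟺ res c ∈ Sel₀^{rel ∞}(H ⊓ ker ρ̄_{E,2}; E[2])`** for EVERY normal `H ≤ Γ_K` (number field `K`,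
elliptic `E = W`): the relaxed-at-`∞` fine conditions with `E[2]`-coefficients descend along `K̄^H(E[2]) / K̄^H` place by place,
because `res : H¹(H ⊓ D_v, E[2]) → H¹(H ⊓ D_v ⊓ ker ρ̄, E[2])` is injective at EVERY finite place and for EVERY image of `ρ̄_{E,2}`
(att-p3 g4 `PerfectDescent.resOfLe_geomTorsion_two_injective`: `E[2]` is a projective `𝔽₂[S₃]`-module). PERFECT-DESCENT.md
§3 (ii), local step, at the Selmer level. [cite: SerreGaloisCohomology1997, I §2.6] [cite: GreenbergLNM1716, §3] -/
theorem mem_relaxedFine_twoCoeff_iff_resOfLe_mem (H : Subgroup (absoluteGaloisGroup K)) [H.Normal] (p : ℕ)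
    (c : subgroupH1 H (W.geomTorsion 2)) :
    c ∈ strictSelmerGroupOverRelaxedInf H (W.geomTorsion 2) p (fineData (W.geomTorsion 2) p) ↔
      resOfLe (W.geomTorsion 2) (inf_le_left : H ⊓ (W.galoisRepTorsion 2).ker ≤ H) c ∈
        strictSelmerGroupOverRelaxedInf (H ⊓ (W.galoisRepTorsion 2).ker) (W.geomTorsion 2) p
          (fineData (W.geomTorsion 2) p) := by
  refine ⟨resOfLe_mem_relaxedFine inf_le_left p, mem_relaxedFine_of_resOfLe_mem inf_le_left p fun v ↦ ?_⟩
  exact PerfectDescent.resOfLe_geomTorsion_two_injective W two_ne_zero _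
    (fun g hg ↦ ⟨⟨hg.1.1, hg.2⟩, hg.1.2⟩)

/-- **The image of `Sel₀^{rel ∞}(H; E[2])` under `res` is EXACTLY the `H`-invariant part of `Sel₀^{rel ∞}(H ⊓ ker ρ̄_{E,2}; E[2])`**
(every normal `H ≤ Γ_K`): `⊆` by functoriality and `conj_g ∘ res = res` for `g ∈ H`; `⊇` by att-p3 g4's surjective half
`PerfectDescent.mem_range_resOfLe_geomTorsion_two_iff` (`H²`-vanishing for the Klein module) and the descent of the local
conditions (`mem_relaxedFine_twoCoeff_iff_resOfLe_mem`). [cite: SerreGaloisCohomology1997, I §2.6 (inflation–restriction)] [cite: GreenbergLNM1716, §3] -/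
theorem image_resOfLe_relaxedFine_twoCoeff_eq (H : Subgroup (absoluteGaloisGroup K)) [H.Normal] (p : ℕ) :
    resOfLe (W.geomTorsion 2) (inf_le_left : H ⊓ (W.galoisRepTorsion 2).ker ≤ H) ''
        (strictSelmerGroupOverRelaxedInf H (W.geomTorsion 2) p (fineData (W.geomTorsion 2) p) :
          Set (subgroupH1 H (W.geomTorsion 2))) =
      {x | x ∈ strictSelmerGroupOverRelaxedInf (H ⊓ (W.galoisRepTorsion 2).ker) (W.geomTorsion 2) p
            (fineData (W.geomTorsion 2) p) ∧
          ∀ g ∈ H, conjH1 (H ⊓ (W.galoisRepTorsion 2).ker) (W.geomTorsion 2) g x = x} := by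
  ext x
  constructor
  · rintro ⟨c, hc, rfl⟩
    exact ⟨(mem_relaxedFine_twoCoeff_iff_resOfLe_mem W H p c).1 hc,
      fun g hg ↦ conjH1_resOfLe_of_mem (M := W.geomTorsion 2) inf_le_left hg c⟩
  · rintro ⟨hx, hinv⟩
    obtain ⟨c, rfl⟩ := (PerfectDescent.mem_range_resOfLe_geomTorsion_two_iff W two_ne_zero H x).2 hinv
    exact ⟨c, (mem_relaxedFine_twoCoeff_iff_resOfLe_mem W H p c).2 hx, rfl⟩

variable {p : ℕ} [Fact p.Prime] (κ : ZpExtension K p)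

/-- **`Sel₀^{rel ∞}(K_∞, E[2]) ≅ Sel₀^{rel ∞}(K_∞(E[2]), E[2])^{Gal(K̄/K_∞)}` as a finiteness statement** — for ANY number field `K`,
ANY `ℤ_p`-extension `κ` (any `p`) and ANY elliptic `E/K`: the relaxed-at-`∞` fine Selmer group of `E[2]` over `K_∞` is finite iff the
set of `Gal(K̄/K_∞)`-invariant classes of the one over `F_∞ = K_∞(E[2])` is finite (`res` is injective, att-p3 g4
`resOfLe_kerSubgroup_inf_ker_galoisRepTorsion_two_injective`, with that image, `image_resOfLe_relaxedFine_twoCoeff_eq`). Upstairs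
`Gal(K̄/F_∞) ≤ ker ρ̄_{E,2}` acts trivially on `E[2]`: the classes are continuous homomorphisms `Gal(K̄/F_∞) → E[2]` killing every
decomposition group at a finite place — the lead's `Hom_{G_∞}(X⁺_{Σ-cs}(F_∞), E[2])` short of class field theory (PERFECT-DESCENT.md
§3 (ii)–(iii)). With `RelaxedCoefficients.finite_fineSelmerInftyRelaxedInf_pTorsion_iff` at `(ℚ, 2)`: (A)₂^{rel ∞}(E) ⟺ this set is finite.
[cite: SerreGaloisCohomology1997, I §2.6] [cite: GreenbergLNM1716, §3] [cite: CoatesSujatha2005, §3 (statement (A))] -/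
theorem finite_relaxedFine_twoCoeff_iff_finite_invariants :
    (fineSelmerInftyRelaxedInf (↥(W.geomTorsion 2)) κ : Set (subgroupH1 κ.kerSubgroup (W.geomTorsion 2))).Finite ↔
      Set.Finite {x : subgroupH1 (κ.kerSubgroup ⊓ (W.galoisRepTorsion 2).ker) (W.geomTorsion 2) |
        x ∈ strictSelmerGroupOverRelaxedInf (κ.kerSubgroup ⊓ (W.galoisRepTorsion 2).ker) (W.geomTorsion 2) p
            (fineData (W.geomTorsion 2) p) ∧
          ∀ g ∈ κ.kerSubgroup, conjH1 (κ.kerSubgroup ⊓ (W.galoisRepTorsion 2).ker) (W.geomTorsion 2) g x = x} := by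
  rw [fineSelmerInftyRelaxedInf_eq, ← image_resOfLe_relaxedFine_twoCoeff_eq W κ.kerSubgroup p]
  exact (Set.finite_image_iff
    (PerfectDescent.resOfLe_kerSubgroup_inf_ker_galoisRepTorsion_two_injective W κ).injOn).symm

end TwoTorsion

end Summit.BirchSwinnertonDyer.BirchSwinnertonDyer.Theorems.AlignedTransportAtTwoFineRoad.RelaxedPerfectDescent

end
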